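import Summits.QuantumFields.YangMills.Theorems.UnitScaleTiltProp7Lane2GradCommH1
import Summits.QuantumFields.YangMills.Theorems.UnitScaleTiltProp7Lane2CutoffPackage
import Summits.QuantumFields.YangMills.Theorems.UnitScaleTiltProp7DeltaEtaAlmostPositive
import Summits.QuantumFields.YangMills.Theorems.UnitScaleTiltProp7SlotRowOfDeltaEta
import Summits.QuantumFields.YangMills.Theorems.UnitScaleTiltProp7SmallFieldThm311
import HarnessLib

/-!
# Route `UnitScaleTilt`, crux «MinimiserStabilityRegPr» (stmt-QuantumFields-19200), E′ ∕ (N06) LANE II «DIVERGENCE RECOVERY AT CURVED `W`» — brick (B6), row `h11` AT THE MEMBER,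
# IN THE (QH1)♮ LETTERS OF ★p1 g19's NAMER WORD №10 (2)(b): for `u := D_W(ζφ) − ζ(·₋)D_Wφ` (φ = toL2S λ, any real cutoff `ζ` with steps `≤ a`, second differences `≤ a₂`),
# `re⟪u, Δ^η_W u⟫ + 1029e‖u‖² + ‖D*_W u‖² ≤ 24ℓ²a²·‖D_Wφ‖² + (18ℓ⁴a₂² + 1728a²e²)·‖φ‖² + 2058e·‖u‖²` on `RegPr F n K e W` (`ℓ = (eta F n K)⁻¹ = L^{K−n}`)

Cell `ym3-torus`, width seat `ym3-torus-px11` (gen 6).  THEOREMS ONLY (0 `def`, 0 `sorry`); `--supports stmt-QuantumFields-19200`, count-neutral.  YM₃ on T³ is a ladder rung (R3), not the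
Clay problem; nothing here claims (B7), (REC), `hN06`, a stub, the crux, d = 4 or the mass gap.

HOW.  `u = toL2 X`, `X(b) = ℓ(ζ(b₊) − ζ(b₋))•Ad(W♭ b)λ(b₊)` (✓`Prop7Lane2CutoffCommutators.DL2_smul_sub_smul_eq_toL2`).  (3.10)–(3.12): `re⟪toL2 X, Δ^η toL2 X⟫ = c₀ℓ²·(Σ_p‖(curl_W X)(p)‖_F² +
re Σ_b tr(X_b†(Δ′X)_b))` (✓`re_inner_DeltaEta_toL2_eq`, ✓`re_sum_trace_conjTranspose_mul_covCodiffCurlT`), the curvature part `|…| ≤ 1029·e·η²·Σ_b‖X_b‖_F²` on `RegPr`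
(✓`norm_sum_trace_conjTranspose_mul_deltaPrimeOp_le`), `‖D*_W toL2 X‖² = c₀ℓ²·Σ_x‖(divB_W X)(x)‖_F²` (✓`norm_sq_DstarL2_toL2_eq`); the lattice curl ∕ div energies of `X` are
✓`Prop7Lane2GradCommH1.hs_curl_gradComm_sum_le` ∕ `hs_divB_gradComm_sum_le`, whose plaquette datum `‖W_μ(x)W_ν(x+e_μ) − W_ν(x)W_μ(x+e_ν)‖ ≤ e·η²` is §1 here (the (6)(e) clause of
`RegPr` through ✓`Prop7CovariantCoercivity.hyp_of_specialUnitary` ∕ `plaqU_hyp`).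
* §1 `norm_transport_comm_le_of_regPr` — the plaquette datum; `re_sum_trace_covCodiffCurlT_gradComm_le` — the `D¹*D¹` part of (3.10) on `X`:
  `≤ 18ℓ²a²·Σ hs(D_Wλ) + 1728ℓ²a²(eη²)²·Σ hs(λ)`.
* §3 ★★★ `curlHS_add_normSq_DstarL2_gradComm_le` — the same row in the LOCAL-ENERGY currency `H f := c₀ℓ²·CURL_HS(f) + ‖D*_W f‖²` of NAMER WORD №13 [I-2](c) (no `e·M` term).
* §2 ★★★ `H1_energy_gradComm_le` — the displayed row (`a`, `a₂`, `e` free; with ✓`exists_partitionOfUnity`'s `a = (3∕2)(Rℓ)⁻¹`, `a₂ = 6(Rℓ)⁻²`, `R = L^s`: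
  `≤ 54·R⁻²‖D_Wφ‖² + 648·R⁻⁴‖φ‖² + 3888·e²R⁻²ℓ⁻²‖φ‖² + 2058e‖u‖²` — (B7-BUDGET)'s `h11` shape `CH(R⁻²Gφ + R⁻⁴Φ)` plus an `e²Φ` and an `e·M` term, both already currencies of
  ✓`Prop7DivRecoveryAssemblyBudget.patch_budget`).
HONEST: Hilbert-space bookkeeping over landed lattice rows; nothing of (B7)∕(REC)∕hN06∕the crux is proved or claimed.

References: T. Bałaban, CMP 99 (1985) 389–434 [Balaban1985BackgroundPropagators] ((3.8)–(3.12) p.392, (3.69) p.404, (3.100) pp.413–414); CMP 102 (1985) 277–309 [Balaban1985Variational]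
((2) p.278, (14) p.280); CMP 96 (1984) 223–250 [Balaban1984PropagatorsII] (p.238).
-/

set_option autoImplicit false

noncomputable section

open scoped BigOperators Matrix.Norms.L2Operator Matrix InnerProductSpace

namespace Summit.QuantumFields.YangMills.Theorems.Prop7Lane2GradCommH1

open Literature.MathematicalPhysics.QuantumFieldTheory.Balaban1983to89
open Literature.MathematicalPhysics.QuantumFieldTheory.Balaban1983to89.T3ContinuumYM3Torus
open Literature.MathematicalPhysics.QuantumFieldTheory.Balaban1983to89.T3PrintedRegularMinimiser (RegPr)
open T3SectALandauChart (bgUnits eta eta_pos formComp covCodiffCurlT)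
open B10Eq27TorusAxialLog (unitsField toUField holT)
open B7Prop1Explicit (U1 mem_U1 plaqWord)
open B9Eq39Adjoint (R covD divB curl plaqU)
open B9TorusCalculus (torusT torusT_apply)
open B11Eq103H1Complex (SiteL2K BondL2K)
open Summit.QuantumFields.YangMills.Theorems.Prop7SectET3Transport (periodsT3)
open Summit.QuantumFields.YangMills.Theorems.Prop7SectET3HilbertLetters (W₂ frobEquiv toL2 toL2S DL2 DstarL2)
open Summit.QuantumFields.YangMills.Theorems.Prop7SectET3WilsonHessian (DeltaEta DeltaEtaSlot DeltaEtaSlot_apply)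
open Summit.QuantumFields.YangMills.Theorems.Prop7DeltaEtaAlmostPositive (re_inner_DeltaEta_toL2_eq norm_toL2_sq)
open Summit.QuantumFields.YangMills.Theorems.Prop7SlotRowOfDeltaEta (re_sum_trace_conjTranspose_mul_covCodiffCurlT)
open Summit.QuantumFields.YangMills.Theorems.Prop7DeltaPrimeL2Bound (norm_sum_trace_conjTranspose_mul_deltaPrimeOp_le)
open Summit.QuantumFields.YangMills.Theorems.Prop7RieszTauFrobNorm (norm_sq_frobEquiv_symm)
open Summit.QuantumFields.YangMills.Theorems.Prop7LaplaceAFlatLetters (norm_sq_toL2S sum_plaq_eq_sum_posPlaq')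
open Summit.QuantumFields.YangMills.Theorems.Prop7DivSliceOfMemberDivSq (norm_sq_DstarL2_toL2_eq inv_eta_sq_eq eta_sq_eq)
open Summit.QuantumFields.YangMills.Theorems.Prop7CovariantCoercivity (hyp_of_specialUnitary plaqU_hyp)
open Summit.QuantumFields.YangMills.Theorems.Prop7Lane2CutoffCommutators (coe_bgUnits_mem_unitary DL2_smul_sub_smul_eq_toL2)
open Summit.QuantumFields.YangMills.Theorems.Prop7Lane2CutoffPackage (norm_sq_DL2_toL2S_covD)
open Finset

variable (F : T3Family) (n K : ℕ)

/-! ## §1 The plaquette datum of `RegPr` and the `D¹*D¹` part on the gradient commutator -/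

/-- **THE PLAQUETTE DATUM**: on `RegPr F n K e W`, `‖W_μ(x)W_ν(x+e_μ) − W_ν(x)W_μ(x+e_ν)‖ ≤ e·η²` for all `x, μ, ν` (`= (W(∂p) − 1)·W_νW_μ′`, `|W(∂p) − 1| ≤ e·L^{−2(K−n)} = e·η²`,
unitary factors). [cite: Balaban1985Variational, (2) p.278; Balaban1985BackgroundPropagators, (3.1) p.390] -/
theorem norm_transport_comm_le_of_regPr {e : ℝ} (he : 0 ≤ e) {W : GaugeField (F.P K) 0 (Matrix.specialUnitaryGroup (Fin 2) ℂ)}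
    (hW : RegPr F n K e W) (x : Site (F.P K) 0) (μ ν : Fin (F.P K).d) :
    ‖((bgUnits F K W ⟨x, μ⟩ * bgUnits F K W ⟨x.shift μ, ν⟩ : (Matrix (Fin 2) (Fin 2) ℂ)ˣ) : Matrix (Fin 2) (Fin 2) ℂ)
        - ((bgUnits F K W ⟨x, ν⟩ * bgUnits F K W ⟨x.shift ν, μ⟩ : (Matrix (Fin 2) (Fin 2) ℂ)ˣ) : Matrix (Fin 2) (Fin 2) ℂ)‖
      ≤ e * eta F n K ^ 2 := by
  have hW2 := hyp_of_specialUnitary W fun p => (hW.plaqSmall p).le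
  have hε : T3RegularMinimiser.regThreshold F n K e = e * eta F n K ^ 2 := by
    show e * ((F.L : ℝ))⁻¹ ^ (2 * (K - n)) = e * eta F n K ^ 2
    rw [eta_sq_eq F n K, inv_pow, pow_mul']
  have hreg0 : 0 ≤ T3RegularMinimiser.regThreshold F n K e := by
    rw [hε]; positivity
  have hP : ‖(plaqU (torusT (F.P K) 0) (fun κ z => bgUnits F K W ⟨z, κ⟩) μ ν x : Matrix (Fin 2) (Fin 2) ℂ) - 1‖ ≤ e * eta F n K ^ 2 := by
    rw [← hε]; exact plaqU_hyp hreg0 hW2.2 μ ν x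
  have hU1 : ∀ b : PBond (F.P K) 0, bgUnits F K W b ∈ U1 (Matrix (Fin 2) (Fin 2) ℂ) := fun b => hW2.1 b
  have hn : ‖((bgUnits F K W ⟨x, ν⟩ * bgUnits F K W ⟨x.shift ν, μ⟩ : (Matrix (Fin 2) (Fin 2) ℂ)ˣ) : Matrix (Fin 2) (Fin 2) ℂ)‖ ≤ 1 :=
    (mem_U1.mp ((U1 (Matrix (Fin 2) (Fin 2) ℂ)).mul_mem (hU1 ⟨x, ν⟩) (hU1 ⟨x.shift ν, μ⟩))).1
  have hg : (bgUnits F K W ⟨x, μ⟩ * bgUnits F K W ⟨x.shift μ, ν⟩ : (Matrix (Fin 2) (Fin 2) ℂ)ˣ)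
      = plaqU (torusT (F.P K) 0) (fun κ z => bgUnits F K W ⟨z, κ⟩) μ ν x * (bgUnits F K W ⟨x, ν⟩ * bgUnits F K W ⟨x.shift ν, μ⟩) := by
    simp only [plaqU, torusT_apply]
    group
  rw [hg, Units.val_mul]
  calc ‖(plaqU (torusT (F.P K) 0) (fun κ z => bgUnits F K W ⟨z, κ⟩) μ ν x : Matrix (Fin 2) (Fin 2) ℂ)
          * ((bgUnits F K W ⟨x, ν⟩ * bgUnits F K W ⟨x.shift ν, μ⟩ : (Matrix (Fin 2) (Fin 2) ℂ)ˣ) : Matrix (Fin 2) (Fin 2) ℂ)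
          - ((bgUnits F K W ⟨x, ν⟩ * bgUnits F K W ⟨x.shift ν, μ⟩ : (Matrix (Fin 2) (Fin 2) ℂ)ˣ) : Matrix (Fin 2) (Fin 2) ℂ)‖
        = ‖((plaqU (torusT (F.P K) 0) (fun κ z => bgUnits F K W ⟨z, κ⟩) μ ν x : Matrix (Fin 2) (Fin 2) ℂ) - 1)
            * ((bgUnits F K W ⟨x, ν⟩ * bgUnits F K W ⟨x.shift ν, μ⟩ : (Matrix (Fin 2) (Fin 2) ℂ)ˣ) : Matrix (Fin 2) (Fin 2) ℂ)‖ := by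
          rw [sub_mul, one_mul]
    _ ≤ ‖(plaqU (torusT (F.P K) 0) (fun κ z => bgUnits F K W ⟨z, κ⟩) μ ν x : Matrix (Fin 2) (Fin 2) ℂ) - 1‖
          * ‖((bgUnits F K W ⟨x, ν⟩ * bgUnits F K W ⟨x.shift ν, μ⟩ : (Matrix (Fin 2) (Fin 2) ℂ)ˣ) : Matrix (Fin 2) (Fin 2) ℂ)‖ := norm_mul_le _ _
    _ ≤ e * eta F n K ^ 2 * 1 := mul_le_mul hP hn (norm_nonneg _) (by positivity)
    _ = e * eta F n K ^ 2 := mul_one _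

/-- **THE `D¹*D¹` PART OF (3.10) ON THE GRADIENT COMMUTATOR**: for `X(b) = t(ζ(b₊) − ζ(b₋))•Ad(W♭ b)λ(b₊)` on `RegPr F n K e W` with steps `|∂ζ| ≤ a`,
`re Σ_b tr(X_b†(D¹*D¹_W X)_b) = Σ_p ‖(curl_W X)(p)‖_F² ≤ Σ_{x,μ,ν} hs(curl_W X) ≤ 18t²a²·Σ_xΣ_μ hs(D_μλ x) + 1728t²a²(eη²)²·Σ_x hs(λ x)`.
[cite: Balaban1985BackgroundPropagators, (3.9)–(3.10) p.392, (3.100) pp.413–414] -/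
theorem re_sum_trace_covCodiffCurlT_gradComm_le {e : ℝ} (he : 0 ≤ e) {W : GaugeField (F.P K) 0 (Matrix.specialUnitaryGroup (Fin 2) ℂ)}
    (hW : RegPr F n K e W) (ζ : Site (F.P K) 0 → ℝ) {a : ℝ} (ha : 0 ≤ a)
    (hstep : ∀ (x : Site (F.P K) 0) (μ : Fin (F.P K).d), |ζ (x.shift μ) - ζ x| ≤ a) (l : Site (F.P K) 0 → Matrix (Fin 2) (Fin 2) ℂ) (t : ℝ)
    (X : PBond (F.P K) 0 → Matrix (Fin 2) (Fin 2) ℂ) (hX : X = fun b => (t * (ζ b.tgt - ζ b.src)) • R (bgUnits F K W b) (l b.tgt)) :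
    (∑ b : PBond (F.P K) 0, Matrix.trace ((X b).conjTranspose * covCodiffCurlT 1 (bgUnits F K W) X b.dir b.src)).re
      ≤ 18 * (t ^ 2 * a ^ 2) * ∑ x : Site (F.P K) 0, ∑ μ : Fin (F.P K).d, ∑ j : Fin 2, ∑ k' : Fin 2,
            ‖(covD (torusT (F.P K) 0) (fun μ z => bgUnits F K W ⟨z, μ⟩) μ l x) j k'‖ ^ 2
        + 1728 * (t ^ 2 * a ^ 2 * (e * eta F n K ^ 2) ^ 2) * ∑ x : Site (F.P K) 0, ∑ j : Fin 2, ∑ k' : Fin 2, ‖l x j k'‖ ^ 2 := by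
  have hW2 := hyp_of_specialUnitary W fun p => (hW.plaqSmall p).le
  have hUu : ∀ (μ : Fin (F.P K).d) (x : Site (F.P K) 0),
      ((bgUnits F K W ⟨x, μ⟩ : (Matrix (Fin 2) (Fin 2) ℂ)ˣ) : Matrix (Fin 2) (Fin 2) ℂ) ∈ unitary (Matrix (Fin 2) (Fin 2) ℂ) :=
    fun μ x => coe_bgUnits_mem_unitary F K W μ x
  have hU1 : ∀ (μ : Fin (F.P K).d) (x : Site (F.P K) 0), bgUnits F K W ⟨x, μ⟩ ∈ U1 (Matrix (Fin 2) (Fin 2) ℂ) := fun μ x => hW2.1 ⟨x, μ⟩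
  have hplaq := fun (x : Site (F.P K) 0) (μ ν : Fin (F.P K).d) => norm_transport_comm_le_of_regPr F n K he hW x μ ν
  have h := hs_curl_gradComm_sum_le (P := F.P K) (fun κ z => bgUnits F K W ⟨z, κ⟩) t ζ l hUu hU1 ha hstep hplaq
  beta_reduce at h
  have hd : ((F.P K).d : ℝ) = 3 := by
    show ((3 : ℕ) : ℝ) = 3
    norm_num
  rw [hd] at h
  have h1 := re_sum_trace_conjTranspose_mul_covCodiffCurlT W X
  rw [RCLike.re_to_complex] at h1
  rw [h1, sum_plaq_eq_sum_posPlaq' (fun x μ ν => ‖(frobEquiv.symm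
      (curl (torusT (F.P K) 0) (fun μ x => bgUnits F K W ⟨x, μ⟩) (formComp X) μ ν x) : W₂)‖ ^ 2)]
  refine (Finset.sum_le_univ_sum_of_nonneg fun q => sq_nonneg _).trans ?_
  simp only [Fintype.sum_prod_type, norm_sq_frobEquiv_symm]
  subst hX
  exact h.trans (le_of_eq (by ring))

/-! ## §2 ★★★ Row `h11` at the member -/

/-- Arithmetic of the curl ∕ curvature prefactors (`t·η = 1`). [folklore] -/
theorem arith_curl {c t η a e G Φ S : ℝ} (h : t * η = 1) :
    c * t ^ 2 * ((18 * (t ^ 2 * a ^ 2) * G + 1728 * (t ^ 2 * a ^ 2 * (e * η ^ 2) ^ 2) * Φ) + 1029 * (e * η ^ 2) * S)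
      = 18 * t ^ 2 * a ^ 2 * (c * t ^ 2 * G) + 1728 * a ^ 2 * e ^ 2 * (c * Φ) + 1029 * e * (c * S) := by
  have h2 : t ^ 2 * η ^ 2 = 1 := by rw [← mul_pow, h, one_pow]
  have h4 : t ^ 4 * η ^ 4 = 1 := by rw [← mul_pow, h, one_pow]
  linear_combination (1728 * a ^ 2 * e ^ 2 * c * Φ) * h4 + (1029 * e * c * S) * h2

/-- Arithmetic of the divergence prefactors. [folklore] -/
theorem arith_div {c t a a₂ G Φ : ℝ} :
    c * t ^ 2 * (6 * t ^ 2 * (3 * a₂ ^ 2 * Φ + a ^ 2 * G)) = 6 * t ^ 2 * a ^ 2 * (c * t ^ 2 * G) + 18 * t ^ 4 * a₂ ^ 2 * (c * Φ) := by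
  ring

variable (c₀ : ℝ) [Fact (0 < c₀)]

/-- ★★★ **ROW `h11` AT THE MEMBER — THE `H¹` ((QH1)♮) ENERGY OF THE GRADIENT COMMUTATOR `u = D_W(ζφ) − ζ(·₋)D_Wφ`**: on `RegPr F n K e W` (`0 < e`), for every real
cutoff `ζ` with `|ζ(x±e_μ) − ζ(x)| ≤ a` and `|ζ(x+e_μ) + ζ(x−e_μ) − 2ζ(x)| ≤ a₂`, and every `λ` (`φ = toL2S λ`),
`re⟪u, Δ^η_W u⟫ + 1029e‖u‖² + ‖D*_W u‖² ≤ 24ℓ²a²·‖D_Wφ‖² + (18ℓ⁴a₂² + 1728a²e²)·‖φ‖² + 2058e·‖u‖²`, `ℓ = (eta F n K)⁻¹`.  With (B6-a)'s `a = (3∕2)(Rℓ)⁻¹`,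
`a₂ = 6(Rℓ)⁻²`: `≤ 54R⁻²‖D_Wφ‖² + (648R⁻⁴ + 3888e²R⁻²ℓ⁻²)‖φ‖² + 2058e‖u‖²`.
[cite: Balaban1985BackgroundPropagators, (3.10)–(3.12) p.392, (3.69) p.404, (3.100) pp.413–414; Balaban1985Variational, (2) p.278] -/
theorem H1_energy_gradComm_le {e : ℝ} (he : 0 < e) {W : GaugeField (F.P K) 0 (Matrix.specialUnitaryGroup (Fin 2) ℂ)} (hW : RegPr F n K e W)
    (ζ : Site (F.P K) 0 → ℝ) {a a₂ : ℝ} (ha : 0 ≤ a)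
    (hζ1 : ∀ (x : Site (F.P K) 0) (μ : Fin (F.P K).d), |ζ (x.shift μ) - ζ x| ≤ a ∧ |ζ (x.unshift μ) - ζ x| ≤ a)
    (hζ2 : ∀ (x : Site (F.P K) 0) (μ : Fin (F.P K).d), |ζ (x.shift μ) + ζ (x.unshift μ) - 2 * ζ x| ≤ a₂)
    (l : Site (F.P K) 0 → Matrix (Fin 2) (Fin 2) ℂ) :
    RCLike.re ⟪DL2 F n K c₀ W (toL2S F K c₀ (fun x => ζ x • l x))
          - toL2 F K c₀ (fun b => ζ b.src • (toL2 F K c₀).symm (DL2 F n K c₀ W (toL2S F K c₀ l)) b),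
        DeltaEtaSlot F n K c₀ W (DL2 F n K c₀ W (toL2S F K c₀ (fun x => ζ x • l x))
          - toL2 F K c₀ (fun b => ζ b.src • (toL2 F K c₀).symm (DL2 F n K c₀ W (toL2S F K c₀ l)) b))⟫_ℂ
      + 1029 * e * ‖DL2 F n K c₀ W (toL2S F K c₀ (fun x => ζ x • l x))
          - toL2 F K c₀ (fun b => ζ b.src • (toL2 F K c₀).symm (DL2 F n K c₀ W (toL2S F K c₀ l)) b)‖ ^ 2
      + ‖DstarL2 F n K c₀ W (DL2 F n K c₀ W (toL2S F K c₀ (fun x => ζ x • l x))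
          - toL2 F K c₀ (fun b => ζ b.src • (toL2 F K c₀).symm (DL2 F n K c₀ W (toL2S F K c₀ l)) b))‖ ^ 2
    ≤ 24 * (eta F n K)⁻¹ ^ 2 * a ^ 2 * ‖DL2 F n K c₀ W (toL2S F K c₀ l)‖ ^ 2
      + (18 * (eta F n K)⁻¹ ^ 4 * a₂ ^ 2 + 1728 * a ^ 2 * e ^ 2) * ‖toL2S F K c₀ l‖ ^ 2
      + 2058 * e * ‖DL2 F n K c₀ W (toL2S F K c₀ (fun x => ζ x • l x))
          - toL2 F K c₀ (fun b => ζ b.src • (toL2 F K c₀).symm (DL2 F n K c₀ W (toL2S F K c₀ l)) b)‖ ^ 2 := by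
  have hη := eta_pos F n K
  have hc₀ : (0 : ℝ) < c₀ := Fact.out
  have hk : 0 ≤ c₀ * (eta F n K)⁻¹ ^ 2 := by positivity
  have hte : (eta F n K)⁻¹ * eta F n K = 1 := inv_mul_cancel₀ hη.ne'
  have hCC := re_sum_trace_covCodiffCurlT_gradComm_le F n K he.le hW ζ ha (fun x μ => (hζ1 x μ).1) l (eta F n K)⁻¹ _ rfl
  have hdiv := hs_divB_gradComm_sum_le F K (fun κ z => bgUnits F K W ⟨z, κ⟩) (eta F n K)⁻¹ ζ l Finset.univ hζ1 hζ2
    (fun x hx => absurd (Finset.mem_univ x) hx)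
  beta_reduce at hdiv
  rw [DL2_smul_sub_smul_eq_toL2 F n K c₀ W ζ l, DeltaEtaSlot_apply, re_inner_DeltaEta_toL2_eq (c₀ := c₀) W, norm_toL2_sq,
    norm_sq_DstarL2_toL2_eq F n K c₀ W, ← inv_eta_sq_eq F n K, norm_sq_DL2_toL2S_covD F n K c₀ W l, norm_sq_toL2S]
  have hD := (Complex.re_le_norm _).trans (norm_sum_trace_conjTranspose_mul_deltaPrimeOp_le he.le W hW
    (fun b : PBond (F.P K) 0 => ((eta F n K)⁻¹ * (ζ b.tgt - ζ b.src)) • R (bgUnits F K W b) (l b.tgt)))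
  refine (add_le_add (add_le_add ((mul_le_mul_of_nonneg_left (add_le_add hCC hD) hk).trans (le_of_eq (arith_curl hte))) le_rfl)
    ((mul_le_mul_of_nonneg_left hdiv hk).trans (le_of_eq arith_div))).trans (le_of_eq ?_)
  ring


/-! ## §3 ★★★ Row `h11` in the `c₀ℓ²·CURL_HS ⊕ ‖D*_W ·‖²` currency of NAMER WORD №13 [I-2](c) -/

/-- Dropping the `μ < ν` indicator on non-negative summands. [folklore] -/
theorem sum_ite_lt_le_sum {S ι : Type*} [Fintype S] [Fintype ι] [LT ι] [DecidableRel (· < · : ι → ι → Prop)] (g : S → ι → ι → ℝ)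
    (hg : ∀ x μ ν, 0 ≤ g x μ ν) :
    ∑ x, ∑ μ, ∑ ν, (if μ < ν then g x μ ν else 0) ≤ ∑ x, ∑ μ, ∑ ν, g x μ ν :=
  Finset.sum_le_sum fun x _ => Finset.sum_le_sum fun μ _ => Finset.sum_le_sum fun ν _ => by
    split_ifs
    · exact le_rfl
    · exact hg x μ ν

/-- Arithmetic of §3 (`t·η = 1`). [folklore] -/
theorem arith_curlHS {c t η a a₂ e G Φ : ℝ} (h : t * η = 1) :
    c * t ^ 2 * (6 * 3 * (t ^ 2 * a ^ 2) * G + 192 * 3 ^ 2 * (t ^ 2 * a ^ 2 * (e * η ^ 2) ^ 2) * Φ)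
        + c * t ^ 2 * (6 * t ^ 2 * (3 * a₂ ^ 2 * Φ + a ^ 2 * G))
      = 24 * t ^ 2 * a ^ 2 * (c * t ^ 2 * G) + (18 * t ^ 4 * a₂ ^ 2 + 1728 * a ^ 2 * e ^ 2) * (c * Φ) := by
  have h4 : t ^ 4 * η ^ 4 = 1 := by rw [← mul_pow, h, one_pow]
  linear_combination (1728 * a ^ 2 * e ^ 2 * c * Φ) * h4

/-- ★★★ **ROW `h11` IN THE LOCAL-ENERGY CURRENCY `H f := c₀ℓ²·CURL_HS(f) + ‖D*_W f‖²`** (the `H` of [I-2](c), `CURL_HS` in the engine's letters of ✓`curlHS_le_re_inner_DeltaEtaSlot`): for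
`u := D_W(ζφ) − ζ(·₋)D_Wφ` as in `H1_energy_gradComm_le`, `H u ≤ 24ℓ²a²·‖D_Wφ‖² + (18ℓ⁴a₂² + 1728a²e²)·‖φ‖²` — no `e·M` term (no curvature form is paired with `u` here).
With (B6-a)'s `a = (3∕2)(Rℓ)⁻¹`, `a₂ = 6(Rℓ)⁻²`: `≤ 54R⁻²‖D_Wφ‖² + (648R⁻⁴ + 3888e²R⁻²ℓ⁻²)‖φ‖²`.
[cite: Balaban1985BackgroundPropagators, (3.4) p.391, (3.8)–(3.11) p.392, (3.100) pp.413–414; Balaban1985Variational, (2) p.278] -/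
theorem curlHS_add_normSq_DstarL2_gradComm_le {e : ℝ} (he : 0 < e) {W : GaugeField (F.P K) 0 (Matrix.specialUnitaryGroup (Fin 2) ℂ)}
    (hW : RegPr F n K e W) (ζ : Site (F.P K) 0 → ℝ) {a a₂ : ℝ} (ha : 0 ≤ a)
    (hζ1 : ∀ (x : Site (F.P K) 0) (μ : Fin (F.P K).d), |ζ (x.shift μ) - ζ x| ≤ a ∧ |ζ (x.unshift μ) - ζ x| ≤ a)
    (hζ2 : ∀ (x : Site (F.P K) 0) (μ : Fin (F.P K).d), |ζ (x.shift μ) + ζ (x.unshift μ) - 2 * ζ x| ≤ a₂)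
    (l : Site (F.P K) 0 → Matrix (Fin 2) (Fin 2) ℂ) :
    c₀ * ((F.L : ℝ) ^ (K - n)) ^ 2 * (∑ x : Site (F.P K) 0, ∑ μ : Fin (F.P K).d, ∑ ν : Fin (F.P K).d,
        (if μ < ν then ∑ j : Fin 2, ∑ k : Fin 2,
          ‖(curl (torusT (F.P K) 0) (fun κ z => unitsField (toUField W) ⟨z, κ⟩)
            (fun κ z => (toL2 F K c₀).symm (DL2 F n K c₀ W (toL2S F K c₀ (fun x => ζ x • l x))
              - toL2 F K c₀ (fun b => ζ b.src • (toL2 F K c₀).symm (DL2 F n K c₀ W (toL2S F K c₀ l)) b)) ⟨z, κ⟩) μ ν x) j k‖ ^ 2 else 0))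
      + ‖DstarL2 F n K c₀ W (DL2 F n K c₀ W (toL2S F K c₀ (fun x => ζ x • l x))
          - toL2 F K c₀ (fun b => ζ b.src • (toL2 F K c₀).symm (DL2 F n K c₀ W (toL2S F K c₀ l)) b))‖ ^ 2
    ≤ 24 * (eta F n K)⁻¹ ^ 2 * a ^ 2 * ‖DL2 F n K c₀ W (toL2S F K c₀ l)‖ ^ 2
      + (18 * (eta F n K)⁻¹ ^ 4 * a₂ ^ 2 + 1728 * a ^ 2 * e ^ 2) * ‖toL2S F K c₀ l‖ ^ 2 := by
  have hη := eta_pos F n K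
  have hc₀ : (0 : ℝ) < c₀ := Fact.out
  have hk : 0 ≤ c₀ * (eta F n K)⁻¹ ^ 2 := by positivity
  have hte : (eta F n K)⁻¹ * eta F n K = 1 := inv_mul_cancel₀ hη.ne'
  have hUf : (fun (κ : Fin (F.P K).d) (z : Site (F.P K) 0) => bgUnits F K W ⟨z, κ⟩) = fun κ z => unitsField (toUField W) ⟨z, κ⟩ := rfl
  -- the lattice rows in `bgUnits` letters
  have hW2 := hyp_of_specialUnitary W fun p => (hW.plaqSmall p).le
  have hUu : ∀ (μ : Fin (F.P K).d) (x : Site (F.P K) 0),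
      ((bgUnits F K W ⟨x, μ⟩ : (Matrix (Fin 2) (Fin 2) ℂ)ˣ) : Matrix (Fin 2) (Fin 2) ℂ) ∈ unitary (Matrix (Fin 2) (Fin 2) ℂ) :=
    fun μ x => coe_bgUnits_mem_unitary F K W μ x
  have hU1 : ∀ (μ : Fin (F.P K).d) (x : Site (F.P K) 0), bgUnits F K W ⟨x, μ⟩ ∈ U1 (Matrix (Fin 2) (Fin 2) ℂ) := fun μ x => hW2.1 ⟨x, μ⟩
  have hplaq := fun (x : Site (F.P K) 0) (μ ν : Fin (F.P K).d) => norm_transport_comm_le_of_regPr F n K he.le hW x μ ν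
  have hcurl := hs_curl_gradComm_sum_le (P := F.P K) (fun κ z => bgUnits F K W ⟨z, κ⟩) (eta F n K)⁻¹ ζ l hUu hU1 ha
    (fun x μ => (hζ1 x μ).1) hplaq
  beta_reduce at hcurl
  have hd : ((F.P K).d : ℝ) = 3 := by
    show ((3 : ℕ) : ℝ) = 3
    norm_num
  rw [hd] at hcurl
  have hdiv := hs_divB_gradComm_sum_le F K (fun κ z => bgUnits F K W ⟨z, κ⟩) (eta F n K)⁻¹ ζ l Finset.univ hζ1 hζ2
    (fun x hx => absurd (Finset.mem_univ x) hx)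
  beta_reduce at hdiv
  have hite := sum_ite_lt_le_sum (fun (x : Site (F.P K) 0) (μ ν : Fin (F.P K).d) => ∑ j : Fin 2, ∑ k : Fin 2,
      ‖(curl (torusT (F.P K) 0) (fun κ z => bgUnits F K W ⟨z, κ⟩)
        (fun κ z => ((eta F n K)⁻¹ * (ζ (z.shift κ) - ζ z)) • R (bgUnits F K W ⟨z, κ⟩) (l (z.shift κ))) μ ν x) j k‖ ^ 2)
    (fun _ _ _ => by positivity)
  beta_reduce at hite
  -- the goal in lattice letters
  rw [DL2_smul_sub_smul_eq_toL2 F n K c₀ W ζ l, LinearEquiv.symm_apply_apply, norm_sq_DstarL2_toL2_eq F n K c₀ W, ← hUf,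
    ← inv_eta_sq_eq F n K, norm_sq_DL2_toL2S_covD F n K c₀ W l, norm_sq_toL2S]
  simp only [PBond.tgt]
  exact le_trans (add_le_add (mul_le_mul_of_nonneg_left (hite.trans hcurl) hk) (mul_le_mul_of_nonneg_left hdiv hk))
    (le_of_eq (arith_curlHS hte))

end Summit.QuantumFields.YangMills.Theorems.Prop7Lane2GradCommH1

end
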